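import Mathlib
import HarnessLib
import Literature.Computability.AlgebraicComplexity.DeterminantalComplexity

/-!
# Symmetric determinantal complexity `sdc(f)`

Topic `Computability/AlgebraicComplexity`, next to `DeterminantalComplexity.lean` (affine
determinantal representations `IsAffineDetRepr f A`, `HasDetRepr f m`, `determinantalComplexity f`).
Requested by route ValiantsHypothesis/SymPencil (definition item `defn-symmDeterminantalComplexity`;
the route inlines the body `A.IsSymm ∧ IsAffineDetRepr f A`).

Sources read, verbatim:

* B. Grenet, E. Kaltofen, P. Koiran, N. Portier, *Symmetric determinantal representation of
  formulas and weakly skew circuits*, Contemp. Math. 556 (2011), arXiv:1007.3804, §1.1: "A linear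
  matrix expression (symmetric linear matrix form, affine symmetric matrix pencil) is a symmetric
  matrix with the entries being linear forms in the variables `x₁, …, xₙ` … `A(x₁,…,xₙ) =
  A₀ + x₁A₁ + ⋯ + xₙAₙ`, `Aᵢ` symmetric"; "Another relaxation is to drop the condition `A₀ ≽ 0`
  and represent any `f` as `det(A)`"; "Our constructions are valid for any field of
  characteristic different from `2`. For fields of characteristic `2`, it can be shown that some
  polynomials (such as e.g. the polynomial `xy + z`) cannot be represented as determinants of
  symmetric matrices [GMT]. Note as a result that the 2-dimensional permanent `xw + yz` cannot be
  'symmetrized' over characteristic `2` with any dimension"; Thm. 2 (formula of skinny size `e` ⇒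
  symmetric `A` of dimension `≤ 2e + 3` with entries inputs and `0, 1, -1, 1/2`), Thm. 4 (weakly
  skew circuit of fat size `m` ⇒ dimension `≤ 2m + 1`).
* K. Sheshadri, *A symmetric determinantal lower bound for diagonal power sums via polar degree*
  (2026), arXiv:2606.11090, §1.1: "Its symmetric determinantal complexity, denoted `sdc(f)`, is
  the least integer `m` for which there exist symmetric matrices `A₀, A₁, …, A_N ∈ ℂ^{m×m}` such
  that `f(x) = Det(A₀ + Σ xᵢAᵢ)`. This is a restriction of ordinary affine determinantal
  complexity `dc(f)` … `sdc(f) ≥ dc(f)`."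

## Definitions (real, with proved API; no named facts)

* `HasSymmDetRepr f m` — `f = det A` for a SYMMETRIC `m × m` matrix `A` of affine linear forms
  (entries of total degree `≤ 1`): `∃ A, A.IsSymm ∧ IsAffineDetRepr f A` (a matrix of affine forms
  is `A₀ + Σ xᵢ Aᵢ` with constant matrices `Aᵢ`; it is symmetric iff all `Aᵢ` are).
* `symmDeterminantalComplexity f = sdc(f) := sInf {m | HasSymmDetRepr f m}`.
* Proved: unfolding lemmas; `HasSymmDetRepr.hasDetRepr`; padding `HasSymmDetRepr.mono`
  (`A ↦ A ⊕ 1`, which stays symmetric and affine); `symmDeterminantalComplexity_le`;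
  `hasSymmDetRepr_symmDeterminantalComplexity` (attained when some representation exists);
  `determinantalComplexity_le_symmDeterminantalComplexity` (`dc ≤ sdc`, under existence);
  `hasSymmDetRepr_X` (a variable has `sdc ≤ 1`); the junk-value lemma.

Junk value: `sdc(f) = 0` iff either no symmetric representation of any size exists (in
characteristic `2`, e.g. `xw + yz`, GKKP §1.1) or `f = 1 = det` of the empty matrix; over fields of
characteristic `≠ 2` a representation always exists (GKKP Thm. 2/4 — NOT vendored here).
-/

open MvPolynomial Matrix

namespace Literature.Computability.AlgebraicComplexity

universe u v

variable {k : Type u} [CommRing k] {σ : Type v}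

/-- `HasSymmDetRepr f m`: `f` is the determinant of a **symmetric** `m × m` matrix of affine linear
forms (entries of total degree `≤ 1`), i.e. `f = det (A₀ + Σᵢ xᵢ Aᵢ)` with all `Aᵢ` symmetric — a
symmetric (affine) determinantal representation of size `m` (Grenet–Kaltofen–Koiran–Portier 2011,
§1.1; Sheshadri 2026, §1.1). [cite: GrenetEtAl2011, §1.1] -/
def HasSymmDetRepr (f : MvPolynomial σ k) (m : ℕ) : Prop :=
  ∃ A : Matrix (Fin m) (Fin m) (MvPolynomial σ k), A.IsSymm ∧ IsAffineDetRepr f A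

/-- The **symmetric determinantal complexity** `sdc(f)`: the least `m` such that `f = det A` for a
symmetric `m × m` matrix `A` of affine linear forms (Sheshadri 2026, §1.1: "the least integer `m`
for which there exist symmetric matrices `A₀, …, A_N` such that `f = Det(A₀ + Σ xᵢAᵢ)`";
GKKP 2011 §1.1). An `sInf` over `ℕ`: junk value `0` iff no symmetric representation of any size
exists (possible only in characteristic `2`, e.g. `xw + yz`; over other fields GKKP Thm. 2/4 give
one) — or genuinely `0` for `f = 1`. [cite: Sheshadri2026SDC, §1.1] -/
noncomputable def symmDeterminantalComplexity (f : MvPolynomial σ k) : ℕ :=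
  sInf {m : ℕ | HasSymmDetRepr f m}

/-- Unfolding: a symmetric representation of size `m` is a symmetric `m × m` matrix with affine
entries and determinant `f`. [cite: GrenetEtAl2011, §1.1] -/
theorem hasSymmDetRepr_iff (f : MvPolynomial σ k) (m : ℕ) :
    HasSymmDetRepr f m ↔ ∃ A : Matrix (Fin m) (Fin m) (MvPolynomial σ k),
      A.IsSymm ∧ (∀ i j, (A i j).totalDegree ≤ 1) ∧ A.det = f :=
  Iff.rfl

/-- Unfolding of `sdc`. [cite: Sheshadri2026SDC, §1.1] -/
theorem symmDeterminantalComplexity_def (f : MvPolynomial σ k) :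
    symmDeterminantalComplexity f = sInf {m : ℕ | HasSymmDetRepr f m} :=
  rfl

/-- A symmetric determinantal representation is in particular a determinantal representation.
[cite: Sheshadri2026SDC, §1.1] -/
theorem HasSymmDetRepr.hasDetRepr {f : MvPolynomial σ k} {m : ℕ} (h : HasSymmDetRepr f m) :
    HasDetRepr f m := by
  obtain ⟨A, -, hA⟩ := h
  exact ⟨A, hA⟩

/-- Padding: `det (A ⊕ 1) = det A`, and `A ⊕ 1` is symmetric with affine entries when `A` is; so a
symmetric representation of size `m` gives one of every size `m' ≥ m`. [folklore] -/
theorem HasSymmDetRepr.mono {f : MvPolynomial σ k} {m m' : ℕ} (h : HasSymmDetRepr f m)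
    (hm : m ≤ m') : HasSymmDetRepr f m' := by
  obtain ⟨A, hAs, hAdeg, hAdet⟩ := h
  obtain ⟨d, rfl⟩ := Nat.exists_eq_add_of_le hm
  -- the block matrix `A ⊕ 1` reindexed along `Fin m ⊕ Fin d ≃ Fin (m + d)`
  let e : Fin m ⊕ Fin d ≃ Fin (m + d) := finSumFinEquiv
  let B : Matrix (Fin m ⊕ Fin d) (Fin m ⊕ Fin d) (MvPolynomial σ k) := Matrix.fromBlocks A 0 0 1
  have hBdeg : ∀ a b, (B a b).totalDegree ≤ 1 := by
    rintro (a | a) (b | b)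
    · simpa [B] using hAdeg a b
    · simp [B]
    · simp [B]
    · simp only [B, Matrix.fromBlocks_apply₂₂, Matrix.one_apply]
      split_ifs <;> simp
  refine ⟨Matrix.reindex e e B, ?_, ?_, ?_⟩
  · -- symmetry
    have hB : B.IsSymm := Matrix.IsSymm.fromBlocks hAs (by simp) Matrix.isSymm_one
    exact hB.submatrix _
  · -- affine entries
    intro i j
    simpa only [Matrix.reindex_apply, Matrix.submatrix_apply] using hBdeg (e.symm i) (e.symm j)
  · -- determinant
    rw [Matrix.det_reindex_self, Matrix.det_fromBlocks_zero₂₁, Matrix.det_one, mul_one, hAdet]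

/-- `sdc(f) ≤ m` for every symmetric representation of size `m`. [cite: Sheshadri2026SDC, §1.1] -/
theorem symmDeterminantalComplexity_le {f : MvPolynomial σ k} {m : ℕ} (h : HasSymmDetRepr f m) :
    symmDeterminantalComplexity f ≤ m :=
  Nat.sInf_le h

/-- If some symmetric representation exists, `sdc(f)` is attained. [cite: Sheshadri2026SDC, §1.1] -/
theorem hasSymmDetRepr_symmDeterminantalComplexity {f : MvPolynomial σ k}
    (h : ∃ m, HasSymmDetRepr f m) : HasSymmDetRepr f (symmDeterminantalComplexity f) :=
  Nat.sInf_mem h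

/-- With a symmetric representation available, every size `≥ sdc(f)` carries one (padding).
[cite: Sheshadri2026SDC, §1.1] -/
theorem hasSymmDetRepr_of_le {f : MvPolynomial σ k} (h : ∃ m, HasSymmDetRepr f m) {m : ℕ}
    (hm : symmDeterminantalComplexity f ≤ m) : HasSymmDetRepr f m :=
  (hasSymmDetRepr_symmDeterminantalComplexity h).mono hm

/-- **`dc(f) ≤ sdc(f)`** ("`sdc(f) ≥ dc(f)`", Sheshadri 2026 §1.1), as soon as some symmetric
representation exists (otherwise `sdc(f)` is the junk value `0`). [cite: Sheshadri2026SDC, §1.1] -/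
theorem determinantalComplexity_le_symmDeterminantalComplexity {f : MvPolynomial σ k}
    (h : ∃ m, HasSymmDetRepr f m) :
    determinantalComplexity f ≤ symmDeterminantalComplexity f :=
  Nat.sInf_le (hasSymmDetRepr_symmDeterminantalComplexity h).hasDetRepr

/-- Junk value: `sdc(f) = 0` iff either no symmetric representation of any size exists or `f` is
the empty determinant (`HasSymmDetRepr f 0`, i.e. `f = 1`). [folklore] -/
theorem symmDeterminantalComplexity_eq_zero_iff (f : MvPolynomial σ k) :
    symmDeterminantalComplexity f = 0 ↔ HasSymmDetRepr f 0 ∨ ∀ m, ¬ HasSymmDetRepr f m := by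
  rw [symmDeterminantalComplexity, Nat.sInf_eq_zero]
  simp only [Set.mem_setOf_eq, Set.eq_empty_iff_forall_notMem]

/-- The empty determinant: `HasSymmDetRepr f 0 ↔ f = 1`. [folklore] -/
theorem hasSymmDetRepr_zero_iff (f : MvPolynomial σ k) : HasSymmDetRepr f 0 ↔ f = 1 := by
  constructor
  · rintro ⟨A, -, -, hA⟩
    rw [← hA, Matrix.det_isEmpty]
  · rintro rfl
    exact ⟨1, Matrix.isSymm_one, fun i => i.elim0, Matrix.det_isEmpty⟩

/-- Sanity / non-vacuity: a variable `xᵢ` is the determinant of the symmetric `1 × 1` matrix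
`(xᵢ)`, so `HasSymmDetRepr (X i) 1` and `sdc(xᵢ) ≤ 1`. [folklore] -/
theorem hasSymmDetRepr_X (i : σ) : HasSymmDetRepr (X i : MvPolynomial σ k) 1 := by
  refine ⟨Matrix.of fun _ _ => X i, ?_, ?_, ?_⟩
  · exact Matrix.IsSymm.ext fun _ _ => rfl
  · intro a b
    simp only [Matrix.of_apply]
    rcases subsingleton_or_nontrivial k with hk | hk
    · rw [Subsingleton.elim (X i : MvPolynomial σ k) 0, totalDegree_zero]
      exact Nat.zero_le _
    · rw [totalDegree_X]
  · simp [Matrix.det_unique]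

/-- Hence `sdc(xᵢ) ≤ 1`. [folklore] -/
theorem symmDeterminantalComplexity_X_le (i : σ) :
    symmDeterminantalComplexity (X i : MvPolynomial σ k) ≤ 1 :=
  symmDeterminantalComplexity_le (hasSymmDetRepr_X i)

end Literature.Computability.AlgebraicComplexity
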